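import Literature.Probability.RandomPlanarGeometry.SeparatedTraces
import HarnessLib

/-!
# Few large traces: a closed form of "finitely many loops of diameter `> ε`"

Topic `Literature/Probability/RandomPlanarGeometry`. Bookkeeping on the Aizenman–Burchard space
`LoopSpace E = Closeds (CurveClass E)` used to transfer local finiteness from critical
percolation to its scaling limits (F. Camia, C. M. Newman, Comm. Math. Phys. 268 (2006),
Thm 2 (ii): almost surely any bounded region meets only finitely many loops of diameter `> ε`;
the field `IsCNLFamily.ae_finite_traces` of `CLE6.lean`), companion of `SeparatedTraces.lean`:

* `LoopSpace.HasSeparatedTraces₂ k ε η L` — `k` members with traces of diameter `≥ ε + η`,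
  pairwise at Hausdorff distance `≥ η` (at `ε = 0` this is `HasSeparatedTraces k η`); stable under
  perturbation of the collection (`sep_of_near`, `HasSeparatedTraces₂.of_edist_lt`), so
  "some such family with `η > 0`" is open (`isOpen_setOf_exists_hasSeparatedTraces₂`);
* `LoopSpace.FewLargeTraces N ε L` — among any `N + 1` members with pairwise distinct traces one
  has diameter `≤ ε`; its negation is witnessed robustly (`not_fewLargeTraces_iff`), so the event
  is CLOSED (`isClosed_setOf_fewLargeTraces`) — the form consumed by the closed-set half of the
  portmanteau theorem — and it implies that the set of traces of diameter `> ε` is finite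
  (`FewLargeTraces.finite`).

## References

* F. Camia, C. M. Newman, Comm. Math. Phys. 268 (2006), Thm 2 (ii) (= arXiv:math/0504036, Thm 3,
  property 2, and Thm 1, second part) [CamiaNewman2006].
* M. Aizenman, A. Burchard, Duke Math. J. 99 (1999), §2.1 [AizenmanBurchardDuke1999].
-/

noncomputable section

open Set Metric

namespace Literature.Probability.RandomPlanarGeometry

variable {E : Type*} [MetricSpace E]

namespace LoopSpace

/-- The collection `L` **has `k` members with traces of diameter `≥ ε + η`, pairwise at Hausdorff
distance `≥ η`**: the two-level form of `HasSeparatedTraces` (`HasSeparatedTraces₂ k 0 η L ↔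
HasSeparatedTraces k η L`, `hasSeparatedTraces₂_zero_iff`), the robust witness of "more than
`k - 1` distinct traces of diameter `> ε`". [folklore] -/
def HasSeparatedTraces₂ (k : ℕ) (ε η : ℝ) (L : LoopSpace E) : Prop :=
  ∃ c : Fin k → CurveClass E, (∀ i, c i ∈ L) ∧ (∀ i, ε + η ≤ diam (c i).range) ∧
    ∀ i j, i ≠ j → η ≤ hausdorffDist (c i).range (c j).range

/-- At level `ε = 0` the two-level family is a separated family in the sense of
`SeparatedTraces.lean`. [folklore] -/
theorem hasSeparatedTraces₂_zero_iff {k : ℕ} {η : ℝ} {L : LoopSpace E} :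
    HasSeparatedTraces₂ k 0 η L ↔ HasSeparatedTraces k η L := by
  simp only [HasSeparatedTraces₂, HasSeparatedTraces, zero_add]

/-- **Perturbation**: members `c'ᵢ` within `η/8` of a two-level separated family `cᵢ` have
traces of diameter `≥ ε + η/2`, pairwise at Hausdorff distance `≥ η/2` — the inner argument of
`closure_setOf_hasSeparatedTraces_subset` (`SeparatedTraces.lean`) restated for two levels
(`CurveClass.diam_range_le`, `CurveClass.hausdorffDist_range_le_dist`). [folklore] -/
theorem sep_of_near {k : ℕ} {ε η : ℝ} {c c' : Fin k → CurveClass E}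
    (hd : ∀ i, ε + η ≤ diam (c i).range) (hs : ∀ i j, i ≠ j → η ≤ hausdorffDist (c i).range (c j).range)
    (hdist : ∀ i, dist (c i) (c' i) < η / 8) :
    (∀ i, ε + η / 2 ≤ diam (c' i).range) ∧ ∀ i j, i ≠ j → η / 2 ≤ hausdorffDist (c' i).range (c' j).range := by
  refine ⟨fun i ↦ ?_, fun i j hij ↦ ?_⟩
  · have h := CurveClass.diam_range_le (c i) (c' i)
    linarith [hd i, hdist i, dist_nonneg (x := c i) (y := c' i)]
  · have hfin₁ := CurveClass.hausdorffEDist_range_ne_top (c i) (c' i)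
    have hfin₂ := CurveClass.hausdorffEDist_range_ne_top (c j) (c' j)
    have t1 : hausdorffDist (c i).range (c j).range ≤
        hausdorffDist (c i).range (c' i).range + hausdorffDist (c' i).range (c j).range :=
      hausdorffDist_triangle hfin₁
    have t2 : hausdorffDist (c' i).range (c j).range ≤
        hausdorffDist (c' i).range (c' j).range + hausdorffDist (c' j).range (c j).range :=
      hausdorffDist_triangle' (by rw [hausdorffEDist_comm]; exact hfin₂)
    have e1 := CurveClass.hausdorffDist_range_le_dist (c i) (c' i)
    have e2 := CurveClass.hausdorffDist_range_le_dist (c j) (c' j)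
    rw [hausdorffDist_comm] at e2
    linarith [hs i j hij, hdist i, hdist j, dist_nonneg (x := c i) (y := c' i)]

/-- **Stability under perturbation of the collection**: a collection at distance `< η/8` from one
with a two-level separated family has one at levels `(ε, η/2)`. [folklore] -/
theorem HasSeparatedTraces₂.of_edist_lt {k : ℕ} {ε η : ℝ} {L L' : LoopSpace E} (h : HasSeparatedTraces₂ k ε η L)
    (hη : 0 < η) (hLL' : edist L L' < ENNReal.ofReal (η / 8)) : HasSeparatedTraces₂ k ε (η / 2) L' := by
  obtain ⟨c, hc, hd, hs⟩ := h
  have hnear : ∀ i, ∃ c' ∈ L', dist (c i) c' < η / 8 := by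
    intro i
    have hH : hausdorffEDist (L : Set (CurveClass E)) L' < ENNReal.ofReal (η / 8) := by
      rw [← TopologicalSpace.Closeds.edist_eq]; exact hLL'
    obtain ⟨c', hc', hlt⟩ := exists_edist_lt_of_hausdorffEDist_lt (hc i) hH
    refine ⟨c', hc', ?_⟩
    rwa [edist_dist, ENNReal.ofReal_lt_ofReal_iff (by positivity)] at hlt
  choose c' hc' hdist using hnear
  obtain ⟨hd', hs'⟩ := sep_of_near hd hs hdist
  exact ⟨c', hc', hd', hs'⟩

/-- The event "some two-level separated family of size `k` above `ε`" is open. [folklore] -/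
theorem isOpen_setOf_exists_hasSeparatedTraces₂ (k : ℕ) (ε : ℝ) :
    IsOpen {L : LoopSpace E | ∃ η : ℝ, 0 < η ∧ HasSeparatedTraces₂ k ε η L} := by
  rw [EMetric.isOpen_iff]
  rintro L ⟨η, hη, h⟩
  refine ⟨ENNReal.ofReal (η / 8), by simpa using hη, fun L' hL' ↦ ⟨η / 2, half_pos hη, h.of_edist_lt hη ?_⟩⟩
  rw [Metric.mem_eball, edist_comm] at hL'
  exact hL'

/-- The collection `L` **has at most `N` distinct traces of diameter `> ε`**: among any `N + 1`
members with pairwise distinct traces, one has diameter `≤ ε` (the closed form of "finitely many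
large loops", Camia–Newman 2006, Thm 2 (ii)). [folklore] -/
def FewLargeTraces (N : ℕ) (ε : ℝ) (L : LoopSpace E) : Prop :=
  ∀ c : Fin (N + 1) → CurveClass E, (∀ i, c i ∈ L) → (∀ i j, i ≠ j → (c i).range ≠ (c j).range) →
    ∃ i, diam (c i).range ≤ ε

/-- Distinct traces of curve classes are at positive Hausdorff distance. [folklore] -/
theorem _root_.Literature.Probability.RandomPlanarGeometry.CurveClass.hausdorffDist_range_pos
    {c c' : CurveClass E} (h : c.range ≠ c'.range) : 0 < hausdorffDist c.range c'.range := by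
  rcases (hausdorffDist_nonneg (s := c.range) (t := c'.range)).lt_or_eq with hlt | heq
  · exact hlt
  · exact absurd ((IsClosed.hausdorffDist_zero_iff_eq (CurveClass.isCompact_range c).isClosed
      (CurveClass.isCompact_range c').isClosed (CurveClass.hausdorffEDist_range_ne_top c c')).1 heq.symm) h

/-- **Not few large traces iff a robust witness**: `L` has `N + 1` members with distinct traces of
diameter `> ε` iff it has a two-level separated family of size `N + 1` above `ε`. [folklore] -/
theorem not_fewLargeTraces_iff {N : ℕ} {ε : ℝ} {L : LoopSpace E} :
    ¬ FewLargeTraces N ε L ↔ ∃ η : ℝ, 0 < η ∧ HasSeparatedTraces₂ (N + 1) ε η L := by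
  classical
  constructor
  · intro h
    simp only [FewLargeTraces, not_forall, not_exists, not_le] at h
    obtain ⟨c, hc, hne, hd⟩ := h
    -- the finite set of the relevant positive quantities
    set T : Finset ℝ := (Finset.univ.image fun i : Fin (N + 1) ↦ diam (c i).range - ε) ∪
      ((Finset.univ.filter fun p : Fin (N + 1) × Fin (N + 1) ↦ p.1 ≠ p.2).image
        fun p ↦ hausdorffDist (c p.1).range (c p.2).range) with hT
    have hTne : T.Nonempty := ⟨_, Finset.mem_union_left _ (Finset.mem_image_of_mem _ (Finset.mem_univ 0))⟩
    have hTpos : ∀ y ∈ T, 0 < y := by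
      intro y hy
      rcases Finset.mem_union.1 hy with hy | hy
      · obtain ⟨i, -, rfl⟩ := Finset.mem_image.1 hy
        linarith [hd i]
      · obtain ⟨p, hp, rfl⟩ := Finset.mem_image.1 hy
        exact CurveClass.hausdorffDist_range_pos (hne p.1 p.2 (Finset.mem_filter.1 hp).2)
    refine ⟨T.min' hTne, (Finset.lt_min'_iff T hTne).2 hTpos, c, hc, fun i ↦ ?_, fun i j hij ↦ ?_⟩
    · have : T.min' hTne ≤ diam (c i).range - ε :=
        Finset.min'_le T _ (Finset.mem_union_left _ (Finset.mem_image_of_mem _ (Finset.mem_univ i)))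
      linarith
    · exact Finset.min'_le T _ (Finset.mem_union_right _
        (Finset.mem_image.2 ⟨(i, j), Finset.mem_filter.2 ⟨Finset.mem_univ _, hij⟩, rfl⟩))
  · rintro ⟨η, hη, c, hc, hd, hs⟩ hfew
    obtain ⟨i, hi⟩ := hfew c hc fun i j hij heq ↦ by
      have := hs i j hij
      rw [heq, hausdorffDist_self_zero] at this
      linarith
    linarith [hd i]

/-- **"At most `N` distinct traces of diameter `> ε`" is a closed event** on the loop space.
[folklore] -/
theorem isClosed_setOf_fewLargeTraces (N : ℕ) (ε : ℝ) : IsClosed {L : LoopSpace E | FewLargeTraces N ε L} := by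
  rw [← isOpen_compl_iff]
  convert isOpen_setOf_exists_hasSeparatedTraces₂ (E := E) (N + 1) ε using 1
  ext L
  exact not_fewLargeTraces_iff

/-- Few large traces means finitely many traces of diameter `> ε`. [folklore] -/
theorem FewLargeTraces.finite {N : ℕ} {ε : ℝ} {L : LoopSpace E} (h : FewLargeTraces N ε L) :
    {s : Set E | ∃ c ∈ L, CurveClass.range c = s ∧ ε < diam s}.Finite := by
  by_contra hinf
  obtain ⟨t, hts, hcard⟩ := (Set.not_finite.1 hinf : Set.Infinite _).exists_subset_card_eq (N + 1)
  set e := (t.equivFinOfCardEq hcard).symm with he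
  have hmem : ∀ i, ((e i : Set E)) ∈ {s : Set E | ∃ c ∈ L, CurveClass.range c = s ∧ ε < diam s} :=
    fun i ↦ hts (e i).2
  choose c hc hrange hdiam using hmem
  obtain ⟨i, hi⟩ := h c hc fun i j hij heq ↦ hij (e.injective (Subtype.ext (by rw [← hrange i, ← hrange j, heq])))
  rw [hrange i] at hi
  linarith [hdiam i]

/-- Monotonicity of the finiteness conclusion in `ε`. [folklore] -/
theorem finite_traces_mono {L : LoopSpace E} {ε ε' : ℝ} (hε : ε ≤ ε')
    (h : {s : Set E | ∃ c ∈ L, CurveClass.range c = s ∧ ε < diam s}.Finite) :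
    {s : Set E | ∃ c ∈ L, CurveClass.range c = s ∧ ε' < diam s}.Finite :=
  h.subset fun _ ⟨c, hc, hr, hd⟩ ↦ ⟨c, hc, hr, hε.trans_lt hd⟩

end LoopSpace

end Literature.Probability.RandomPlanarGeometry
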